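import Literature.NumberTheory.QuadraticForms.LandherrHermitianPlanes
import HarnessLib

/-!
# Landherr's theorem for hermitian planes over a CM field: necessity of the invariants, and the `iff`

Topic `NumberTheory/QuadraticForms`; theorems only (no definition, no named fact, no instance).
Companion of `LandherrHermitianPlanes.lean` (sufficiency). For a CM field `K` with complex
conjugation `σ = IsCMField.complexConj K` and non-zero `σ`-fixed `a₀, a₁, a₂, a₃`:

* `Landherr.invariants_of_isometry` — an isometry `ᵗ(σ g) · diag(a₀,a₁) · g = diag(a₂,a₃)`,
  `g ∈ GL₂(K)`, forces equal signs at every complex embedding and `a₀a₁ = a₂a₃ N(z)` with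
  `z = (det g)⁻¹` (elementary: determinant and diagonal entries of the identity, then a four-way
  sign analysis = Sylvester's law of inertia for binary hermitian forms);
* `hermitianPlanes_invariants_of_isometric` — the same with the isometry as an `∃`;
* `hermitianPlanes_isometric_iff_invariants` — **Landherr's classification of hermitian planes
  over a CM field** as an `iff` (Landherr 1936; Deligne LNM 900 Prop. 4.1: hermitian forms
  relative to `K/K⁺` are classified by rank, discriminant in `K⁺ˣ/N(Kˣ)` and signatures), the
  sufficiency being `hermitianPlanes_isometric_of_invariants` (Hasse–Minkowski over `K⁺`).

Proof of necessity: the determinant of the isometry identity gives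
`σ(det g) · a₀a₁ · det g = a₂a₃`, whence `a₀a₁ = a₂a₃ N((det g)⁻¹)`; the diagonal entries give
`a₀ N(g₀₀) + a₁ N(g₁₀) = a₂`, `a₀ N(g₀₁) + a₁ N(g₁₁) = a₃`; at an embedding `τ` these become real
identities `r₀‖·‖² + r₁‖·‖² = r₂`, `… = r₃`, `r₀r₁‖τ det g‖² = r₂r₃` (`rᵢ = Re τ(aᵢ) = τ(aᵢ)`),
from which the two sign multisets agree. No arithmetic input.

Provenance: `pub-hodgecm` reproduction of the arithmetic inputs of Deligne's "Hodge cycles on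
abelian varieties" §4–5; ported to Mathlib vocabulary from that package's `LandherrNecessity.lean`.

## References

* W. Landherr, Abh. Math. Sem. Univ. Hamburg 11 (1936) 245–248 [Landherr1936HermitianForms].
* P. Deligne, *Hodge cycles on abelian varieties*, LNM 900 (1982), §4 Prop. 4.1
  [Deligne1982HodgeCycles].
* W. Scharlau, *Quadratic and Hermitian Forms*, Grundlehren 270 (1985), Ch. 10
  [Scharlau1985HermitianForms].
-/

noncomputable section

open NumberField
open scoped Matrix ComplexConjugate

namespace Literature.NumberTheory.QuadraticForms

namespace Landherr

variable (K : Type) [Field K] [NumberField K] [IsCMField K]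

variable {K} in
/-- A `σ`-fixed element of a CM field is real at every complex embedding. [folklore] -/
theorem embedding_eq_re {x : K} (hx : IsCMField.complexConj K x = x) (τ : K →+* ℂ) :
    τ x = ((τ x).re : ℂ) := by
  have h := IsCMField.complexEmbedding_complexConj K τ x
  rw [hx] at h
  exact (Complex.conj_eq_iff_re.mp h.symm).symm

/-- `τ (x · σ x) = ‖τ x‖²` at every complex embedding `τ` of a CM field. [folklore] -/
theorem embedding_mul_complexConj (τ : K →+* ℂ) (x : K) :
    τ (x * IsCMField.complexConj K x) = ((‖τ x‖ ^ 2 : ℝ) : ℂ) := by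
  rw [map_mul, IsCMField.complexEmbedding_complexConj, Complex.mul_conj, Complex.normSq_eq_norm_sq]

variable {K} in
/-- `τ (a · x · σ x)` is the real number `Re τ(a) · ‖τ x‖²` for `σ`-fixed `a`. [folklore] -/
theorem embedding_mul_norm {a x : K} (ha : IsCMField.complexConj K a = a) (τ : K →+* ℂ) :
    τ (a * (x * IsCMField.complexConj K x)) = (((τ a).re * ‖τ x‖ ^ 2 : ℝ) : ℂ) := by
  rw [map_mul, embedding_mul_complexConj K, embedding_eq_re ha τ]
  push_cast
  simp

/-- **Necessity of Landherr's invariants (rank 2).** If `g ∈ GL₂(K)` is an isometry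
`ᵗ(σ g) · diag(a₀, a₁) · g = diag(a₂, a₃)` between non-degenerate diagonal hermitian planes with
`σ`-fixed entries over the CM field `K`, then the planes have the same signs at every complex
embedding and the same discriminant class: `a₀a₁ = a₂a₃ · N(z)` with `z = (det g)⁻¹`.
[cite: Landherr1936HermitianForms] -/
theorem invariants_of_isometry (a : Fin 4 → K) (ha : ∀ i, IsCMField.complexConj K (a i) = a i)
    (ha0 : ∀ i, a i ≠ 0) (g : GL (Fin 2) K)
    (hg : ((g : Matrix (Fin 2) (Fin 2) K).transpose.map (IsCMField.complexConj K)) *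
        Matrix.diagonal ![a 0, a 1] * (g : Matrix (Fin 2) (Fin 2) K) = Matrix.diagonal ![a 2, a 3]) :
    (∀ τ : K →+* ℂ,
      ({decide (0 < (τ (a 0)).re), decide (0 < (τ (a 1)).re)} : Multiset Bool) =
        {decide (0 < (τ (a 2)).re), decide (0 < (τ (a 3)).re)}) ∧
    ∃ z : K, z ≠ 0 ∧ a 0 * a 1 = a 2 * a 3 * (z * IsCMField.complexConj K z) := by
  set G : Matrix (Fin 2) (Fin 2) K := (g : Matrix (Fin 2) (Fin 2) K) with hG
  have hD : G.det ≠ 0 := (Matrix.isUnits_det_units g).ne_zero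
  -- the two diagonal entries of the isometry identity
  have e00 : a 0 * (G 0 0 * IsCMField.complexConj K (G 0 0)) +
      a 1 * (G 1 0 * IsCMField.complexConj K (G 1 0)) = a 2 := by
    have h := congrArg (fun M => M 0 0) hg
    simp only [Matrix.mul_apply, Fin.sum_univ_two, Matrix.diagonal, Matrix.map_apply,
      Matrix.transpose_apply, Matrix.of_apply] at h
    simp at h
    linear_combination h
  have e11 : a 0 * (G 0 1 * IsCMField.complexConj K (G 0 1)) +
      a 1 * (G 1 1 * IsCMField.complexConj K (G 1 1)) = a 3 := by
    have h := congrArg (fun M => M 1 1) hg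
    simp only [Matrix.mul_apply, Fin.sum_univ_two, Matrix.diagonal, Matrix.map_apply,
      Matrix.transpose_apply, Matrix.of_apply] at h
    simp at h
    linear_combination h
  -- the determinant of the isometry identity
  have edet : (a 0 * a 1) * (G.det * IsCMField.complexConj K G.det) = a 2 * a 3 := by
    have h := congrArg Matrix.det hg
    rw [Matrix.det_mul, Matrix.det_mul] at h
    have h1 : (G.transpose.map (IsCMField.complexConj K)).det = IsCMField.complexConj K G.det := by
      rw [← AlgEquiv.mapMatrix_apply, ← AlgEquiv.map_det, Matrix.det_transpose]
    rw [h1, Matrix.det_diagonal, Matrix.det_diagonal, Fin.prod_univ_two, Fin.prod_univ_two] at h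
    simp at h
    linear_combination h
  refine ⟨fun τ => ?_, ⟨G.det⁻¹, inv_ne_zero hD, ?_⟩⟩
  · -- signs at `τ`
    have hr : ∀ i, τ (a i) = (((τ (a i)).re : ℝ) : ℂ) := fun i => embedding_eq_re (ha i) τ
    have hr0 : ∀ i, (τ (a i)).re ≠ 0 := by
      intro i h0
      exact ha0 i ((map_eq_zero τ).mp (by rw [hr i, h0]; simp))
    have f00 : (τ (a 0)).re * ‖τ (G 0 0)‖ ^ 2 + (τ (a 1)).re * ‖τ (G 1 0)‖ ^ 2 = (τ (a 2)).re := by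
      have h := congrArg τ e00
      rw [map_add, embedding_mul_norm (ha 0), embedding_mul_norm (ha 1), hr 2] at h
      exact_mod_cast h
    have f11 : (τ (a 0)).re * ‖τ (G 0 1)‖ ^ 2 + (τ (a 1)).re * ‖τ (G 1 1)‖ ^ 2 = (τ (a 3)).re := by
      have h := congrArg τ e11
      rw [map_add, embedding_mul_norm (ha 0), embedding_mul_norm (ha 1), hr 3] at h
      exact_mod_cast h
    have fdet : (τ (a 0)).re * (τ (a 1)).re * ‖τ G.det‖ ^ 2 = (τ (a 2)).re * (τ (a 3)).re := by
      have h := congrArg τ edet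
      rw [map_mul τ (a 0 * a 1), map_mul τ (a 0) (a 1), map_mul τ (a 2) (a 3),
        embedding_mul_complexConj K, hr 0, hr 1, hr 2, hr 3] at h
      exact_mod_cast h
    have hdd : 0 < ‖τ G.det‖ ^ 2 := by
      have : τ G.det ≠ 0 := (map_ne_zero τ).mpr hD
      positivity
    have n00 : 0 ≤ ‖τ (G 0 0)‖ ^ 2 := by positivity
    have n10 : 0 ≤ ‖τ (G 1 0)‖ ^ 2 := by positivity
    have n01 : 0 ≤ ‖τ (G 0 1)‖ ^ 2 := by positivity
    have n11 : 0 ≤ ‖τ (G 1 1)‖ ^ 2 := by positivity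
    -- four-way sign analysis
    rcases lt_or_gt_of_ne (hr0 0) with h0 | h0 <;> rcases lt_or_gt_of_ne (hr0 1) with h1 | h1
    · -- both negative
      have h2 : (τ (a 2)).re < 0 := lt_of_le_of_ne (by nlinarith) (hr0 2)
      have h3 : (τ (a 3)).re < 0 := lt_of_le_of_ne (by nlinarith) (hr0 3)
      simp [lt_asymm h0, lt_asymm h1, lt_asymm h2, lt_asymm h3]
    · -- `a₀ < 0 < a₁`
      have h23 : (τ (a 2)).re * (τ (a 3)).re < 0 := by
        rw [← fdet]; exact mul_neg_of_neg_of_pos (mul_neg_of_neg_of_pos h0 h1) hdd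
      rcases lt_or_gt_of_ne (hr0 2) with h2 | h2
      · have h3 : 0 < (τ (a 3)).re := by
          by_contra h3
          exact absurd h23 (not_lt.mpr (mul_nonneg_of_nonpos_of_nonpos h2.le (not_lt.mp h3)))
        simp [lt_asymm h0, h1, lt_asymm h2, h3]
      · have h3 : (τ (a 3)).re < 0 := by
          by_contra h3
          exact absurd h23 (not_lt.mpr (mul_nonneg h2.le (not_lt.mp h3)))
        simp [lt_asymm h0, h1, h2, lt_asymm h3]
        exact Multiset.pair_comm _ _
    · -- `a₁ < 0 < a₀`
      have h23 : (τ (a 2)).re * (τ (a 3)).re < 0 := by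
        rw [← fdet]; exact mul_neg_of_neg_of_pos (mul_neg_of_pos_of_neg h0 h1) hdd
      rcases lt_or_gt_of_ne (hr0 2) with h2 | h2
      · have h3 : 0 < (τ (a 3)).re := by
          by_contra h3
          exact absurd h23 (not_lt.mpr (mul_nonneg_of_nonpos_of_nonpos h2.le (not_lt.mp h3)))
        simp [h0, lt_asymm h1, lt_asymm h2, h3]
        exact Multiset.pair_comm _ _
      · have h3 : (τ (a 3)).re < 0 := by
          by_contra h3
          exact absurd h23 (not_lt.mpr (mul_nonneg h2.le (not_lt.mp h3)))
        simp [h0, lt_asymm h1, h2, lt_asymm h3]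
    · -- both positive
      have h2 : 0 < (τ (a 2)).re := lt_of_le_of_ne (by nlinarith) (hr0 2).symm
      have h3 : 0 < (τ (a 3)).re := lt_of_le_of_ne (by nlinarith) (hr0 3).symm
      simp [h0, h1, h2, h3]
  · -- discriminant class
    obtain ⟨u, hu⟩ : ∃ u : K, u = G.det⁻¹ := ⟨_, rfl⟩
    have hu1 : u * G.det = 1 := by rw [hu]; exact inv_mul_cancel₀ hD
    have hu2 : IsCMField.complexConj K u * IsCMField.complexConj K G.det = 1 := by
      have h := congrArg (IsCMField.complexConj K) hu1
      rwa [map_mul, map_one] at h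
    rw [← hu]
    linear_combination (u * IsCMField.complexConj K u) * edet
      - (a 0 * a 1 * (IsCMField.complexConj K u * IsCMField.complexConj K G.det)) * hu1
      - (a 0 * a 1) * hu2

end Landherr

/-- **Necessity of Landherr's invariants for hermitian planes over a CM field.** If the diagonal
hermitian planes `⟨a₀, a₁⟩` and `⟨a₂, a₃⟩` (`aᵢ ∈ K⁺ˣ`) over the CM field `K` are isometric
(`ᵗ(σ g) · diag(a₀,a₁) · g = diag(a₂,a₃)` for some `g ∈ GL₂(K)`), then they have the same signs
at every complex embedding and `a₀a₁ ≡ a₂a₃` in `K⁺ˣ/N(Kˣ)`. [cite: Landherr1936HermitianForms] -/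
theorem hermitianPlanes_invariants_of_isometric (K : Type) [Field K] [NumberField K] [IsCMField K]
    (a : Fin 4 → K) (ha : ∀ i, IsCMField.complexConj K (a i) = a i) (ha0 : ∀ i, a i ≠ 0)
    (hiso : ∃ g : GL (Fin 2) K,
      ((g : Matrix (Fin 2) (Fin 2) K).transpose.map (IsCMField.complexConj K)) *
          Matrix.diagonal ![a 0, a 1] * (g : Matrix (Fin 2) (Fin 2) K) =
        Matrix.diagonal ![a 2, a 3]) :
    (∀ τ : K →+* ℂ,
      ({decide (0 < (τ (a 0)).re), decide (0 < (τ (a 1)).re)} : Multiset Bool) =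
        {decide (0 < (τ (a 2)).re), decide (0 < (τ (a 3)).re)}) ∧
    ∃ z : K, z ≠ 0 ∧ a 0 * a 1 = a 2 * a 3 * (z * IsCMField.complexConj K z) := by
  obtain ⟨g, hg⟩ := hiso
  exact Landherr.invariants_of_isometry K a ha ha0 g hg

/-- **Landherr's classification of hermitian planes over a CM field** (Landherr 1936; Deligne,
LNM 900 Prop. 4.1; Scharlau Ch. 10 — rank `2` in coordinates): for non-zero `σ`-fixed
`a₀, a₁, a₂, a₃` in the CM field `K`, the diagonal hermitian planes `⟨a₀, a₁⟩` and `⟨a₂, a₃⟩` are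
isometric iff they have the same signs at every complex embedding of `K` (equal signatures) and
`a₀a₁ = a₂a₃ N(z)` for some `z ∈ Kˣ` (equal discriminants in `K⁺ˣ/N(Kˣ)`). Sufficiency is
`hermitianPlanes_isometric_of_invariants` (Hasse–Minkowski over `K⁺`), necessity is
`hermitianPlanes_invariants_of_isometric`. [cite: Landherr1936HermitianForms] -/
theorem hermitianPlanes_isometric_iff_invariants (K : Type) [Field K] [NumberField K] [IsCMField K]
    (a : Fin 4 → K) (ha : ∀ i, IsCMField.complexConj K (a i) = a i) (ha0 : ∀ i, a i ≠ 0) :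
    (∃ g : GL (Fin 2) K,
      ((g : Matrix (Fin 2) (Fin 2) K).transpose.map (IsCMField.complexConj K)) *
          Matrix.diagonal ![a 0, a 1] * (g : Matrix (Fin 2) (Fin 2) K) =
        Matrix.diagonal ![a 2, a 3]) ↔
    ((∀ τ : K →+* ℂ,
      ({decide (0 < (τ (a 0)).re), decide (0 < (τ (a 1)).re)} : Multiset Bool) =
        {decide (0 < (τ (a 2)).re), decide (0 < (τ (a 3)).re)}) ∧
    ∃ z : K, z ≠ 0 ∧ a 0 * a 1 = a 2 * a 3 * (z * IsCMField.complexConj K z)) :=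
  ⟨fun hiso => hermitianPlanes_invariants_of_isometric K a ha ha0 hiso,
   fun h => hermitianPlanes_isometric_of_invariants K a ha ha0 h.1 h.2⟩

end Literature.NumberTheory.QuadraticForms

end
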